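import Mathlib.GroupTheory.SemidirectProduct
import Mathlib.LinearAlgebra.UnitaryGroup
import Literature.MathematicalPhysics.QuantumLattice.FermionRelabelling
import Literature.MathematicalPhysics.QuantumLattice.FermionOperatorsParityProofs
import HarnessLib

/-!
# The graded (second-quantised) action of the hyperoctahedral group `ℤ₂ ≀ S_Λ` on fermionic
# Fock space

Topic `Literature/MathematicalPhysics/QuantumLattice`; definition request
`defn-GradedHyperoctahedralFockAction` (idea card hyperoctahedral-mott-algebra D1–D3, route
HubbardSuperconductivity/HyperoctahedralMott, item stmt-HubbardSuperconductivity-6673), in the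
`HubbardWave0` vocabulary (`Fock`, `creation`, `annihilation`, `vacuum`, `Orb Λ = Λ ×ₗ Fin 2`,
`orb`, `numberOp`, `totalNumber`, `spinZ`, `spinPlus`, `spinSq`) and on top of the tree's
relabelling theory `FermionRelabelling.lean` (`relabelSign`, `relabel e`, `Orb.mapEquiv`).

## Contents (everything PROVED; no named facts)

* `relabelMatrix e` — the SIGNED PERMUTATION MATRIX `Γ(e) : |t⟩ ↦ ε_e(t) |e t⟩` of an orbital
  bijection (the Fock-space unitary implementing the one-particle permutation, Bratteli–Robinson
  II Thm 5.2.5), with: unitarity (`relabelMatrix_mul_conjTranspose`,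
  `conjTranspose_mul_relabelMatrix`), `relabel e a = Γ a Γᴴ` (`relabel_eq_relabelMatrix_mul`, so
  all covariance theorems of `FermionRelabelling.lean` transfer), `Γ c†_i Γᴴ = c†_{e i}`,
  `Γ c_i Γᴴ = c_{e i}`, `Γ |vac⟩ = |vac⟩`, `Γ(id) = 1`, and the COCYCLE / homomorphism property
  `Γ(e ∘ f) = Γ(e) Γ(f)` (`relabelMatrix_trans`, from `relabelSign_trans`:
  `ε_{e∘f}(t) = ε_f(t) ε_e(f t)`, proved by pairing ordered pairs in the inversion count).
* `eq_one_of_commute_creation_of_mulVec_vacuum` — the uniqueness principle (cyclicity of the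
  vacuum): an operator commuting with all `c†_i` and fixing `|vac⟩` is `1`; hence the unitary
  implementing a given relabelling of the `c†`'s and fixing the vacuum is unique (the tool for
  identifying `π` of a transposition with explicit polynomials in `c, c†`, see "Not here").
* `signAut`, `Hyperoctahedral Λ = (Λ → ℤˣ) ⋊[signAut] Equiv.Perm Λ` — the hyperoctahedral group
  `B_Λ = ℤ₂ ≀ S_Λ` (Mathlib `SemidirectProduct`); `reflectAt x` the coordinate reflection `r_x`.
* `reflectionSign`, `reflectionMatrix ε = diag(∏_{(x,σ)∈s} ε_x) = ∏_x ε_x^{n_x}`, `reflectionRep`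
  (a homomorphism `(ℤ₂)^Λ →* U(𝓕)`), `permRep : S_Λ →* U(𝓕)` (`g ↦ Γ(Orb.mapEquiv g)`), their
  compatibility `Γ(g) R(ε) Γ(g)⁻¹ = R(g·ε)` (`permRep_conj_reflectionRep`), and
* **`gradedHyperoctahedralFockAction : Hyperoctahedral Λ →* Matrix.unitaryGroup (Finset (Orb Λ)) ℂ`**
  — the unitary representation `π` (by `SemidirectProduct.lift`), with the API:
  `π(inr g) = Γ(g)`, `π(inl ε) = R(ε)`; `π(g) c†_{xσ} π(g)ᴴ = c†_{g x,σ}` and the same for `c`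
  and `n_{xσ}`; `π(g)|vac⟩ = |vac⟩ = π(ε)|vac⟩`; `π(g)` commutes with `N`, `S^z`, `S⁺`, `S²`
  (`…_inr_mul_totalNumber`, `…_inr_mul_spin`); `π(ε)` commutes with every `n_{xσ}`;
  `π(r_x) = (1 - 2n_{x↑})(1 - 2n_{x↓}) = (-1)^{n_x}` (`…_reflectAt`); and the Hubbard
  interaction identity `U ∑_x (n_{x↑} - ½)(n_{x↓} - ½) = (U/4) ∑_x π(r_x)`
  (`hubbardInteraction_eq_sum_reflectAt`; `½` written as `diagonal (fun _ => 1/2)`).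

## Not here (follow-ups)

* The TRANSPOSITION FORMULA `π((x y)) = ∏_σ [1 - (c†_{xσ} - c†_{yσ})(c_{xσ} - c_{yσ})]` (the
  route's inline `Sw x y`): by `eq_one_of_commute_creation_of_mulVec_vacuum` it reduces to the CAR
  computation `[1 - (a† - b†)(a - b)] a† = b† [1 - (a† - b†)(a - b)]` for two distinct modes plus
  commutation with the other modes; not carried out in this file.
* Commutation with `gutzwillerProj`; centrality of the class sums `∑_{x<y} π((x y))`,
  `∑_x π(r_x)` in `π(ℂ[B_Λ])` (immediate from the homomorphism property once stated).

## References

* O. Bratteli, D. W. Robinson, *Operator Algebras and Quantum Statistical Mechanics II* (1997),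
  §5.2.2, Thm 5.2.5 (second quantisation `Γ(U)` of one-particle unitaries; here `U` = signed
  permutations). [BratteliRobinsonII1997]
* P. A. M. Dirac, Proc. R. Soc. A 123 (1929) 714 (exchange as a permutation operator);
  S. Sarkar, J. Phys. A 24 (1991) 1137; F. Essler, V. Korepin, Phys. Rev. B 46 (1992) 9147
  (graded permutations in the supersymmetric `t`-`J` model); A. Regev, J. Algebra (1986);
  A. Sergeev, Mat. Sb. 123 (1984) (wreath product `ℤ₂ ≀ S_n`, double centraliser) — context for
  the request; no statement of theirs is asserted here.
-/

noncomputable section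

namespace Literature.MathematicalPhysics.QuantumLattice

open Matrix Finset HubbardWave0

/-! ### The signed permutation matrix of an orbital bijection -/

section RelabelMatrix

variable {ι ι' ι'' : Type*} [LinearOrder ι] [LinearOrder ι'] [LinearOrder ι'']

/-- **The signed permutation matrix `Γ(e)` of an orbital bijection** `e : ι ≃ ι'` on the
occupation bases: `Γ(e) |t⟩ = ε_e(t) |e(t)⟩`, `ε_e(t) = relabelSign e t` the sign of the
permutation sorting the `e`-images of the increasing enumeration of `t` — the Fock-space
(second-quantised) unitary `Γ(P_e)` implementing the one-particle permutation `P_e`, whose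
conjugation action is the tree's `relabel e` (`relabel_eq_relabelMatrix_mul`).
[cite: BratteliRobinsonII1997, §5.2.2, Thm. 5.2.5 (Fock representation; unitarily implemented Bogoliubov transformations)] -/
def relabelMatrix (e : ι ≃ ι') : Matrix (Finset ι') (Finset ι) ℂ :=
  fun s' t => if s' = e.finsetCongr t then relabelSign e t else 0

/-- Entries of `Γ(e)` in the relabelled row basis: `Γ(e)_{e s, t} = δ_{s,t} ε_e(t)`. [folklore] -/
theorem relabelMatrix_apply_finsetCongr (e : ι ≃ ι') (s t : Finset ι) :
    relabelMatrix e (e.finsetCongr s) t = if s = t then relabelSign e t else 0 := by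
  simp only [relabelMatrix, e.finsetCongr.injective.eq_iff]

variable [Fintype ι] [Fintype ι'] [Fintype ι'']

omit [Fintype ι'] in
/-- `Γ(e)` is a co-isometry: `Γ(e) Γ(e)ᴴ = 1`. [folklore] -/
theorem relabelMatrix_mul_conjTranspose (e : ι ≃ ι') :
    relabelMatrix e * (relabelMatrix e)ᴴ = 1 := by
  ext s' u'
  obtain ⟨s, rfl⟩ := e.finsetCongr.surjective s'
  obtain ⟨u, rfl⟩ := e.finsetCongr.surjective u'
  rw [Matrix.mul_apply, Finset.sum_eq_single s]
  · rw [conjTranspose_apply, relabelMatrix_apply_finsetCongr, relabelMatrix_apply_finsetCongr,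
      if_pos rfl, Matrix.one_apply]
    by_cases h : u = s
    · subst h; simp [star_relabelSign, relabelSign_mul_self]
    · have h' : e.finsetCongr s ≠ e.finsetCongr u := fun h'' => h (e.finsetCongr.injective h'').symm
      rw [if_neg h, if_neg h', star_zero, mul_zero]
  · intro t _ hts
    rw [relabelMatrix_apply_finsetCongr, if_neg (Ne.symm hts), zero_mul]
  · intro h; exact (h (Finset.mem_univ _)).elim

/-- `Γ(e)` is an isometry: `Γ(e)ᴴ Γ(e) = 1`. [folklore] -/
theorem conjTranspose_mul_relabelMatrix (e : ι ≃ ι') :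
    (relabelMatrix e)ᴴ * relabelMatrix e = 1 := by
  ext t u
  rw [Matrix.mul_apply, ← e.finsetCongr.sum_comp, Finset.sum_eq_single t]
  · rw [conjTranspose_apply, relabelMatrix_apply_finsetCongr, relabelMatrix_apply_finsetCongr,
      if_pos rfl, Matrix.one_apply]
    by_cases h : t = u
    · subst h; simp [star_relabelSign, relabelSign_mul_self]
    · rw [if_neg h, if_neg h, mul_zero]
  · intro s _ hst
    rw [conjTranspose_apply, relabelMatrix_apply_finsetCongr, if_neg hst, star_zero, zero_mul]
  · intro h; exact (h (Finset.mem_univ _)).elim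

/-- **`relabel e` is conjugation by `Γ(e)`**: `relabel e a = Γ(e) a Γ(e)ᴴ`. [folklore] -/
theorem relabel_eq_relabelMatrix_mul (e : ι ≃ ι') (a : Matrix (Finset ι) (Finset ι) ℂ) :
    relabel e a = relabelMatrix e * a * (relabelMatrix e)ᴴ := by
  ext s' t'
  obtain ⟨s, rfl⟩ := e.finsetCongr.surjective s'
  obtain ⟨t, rfl⟩ := e.finsetCongr.surjective t'
  rw [relabel_apply_finsetCongr, Matrix.mul_apply, Finset.sum_eq_single t]
  · rw [conjTranspose_apply, relabelMatrix_apply_finsetCongr, if_pos rfl, star_relabelSign,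
      Matrix.mul_apply, Finset.sum_eq_single s]
    · rw [relabelMatrix_apply_finsetCongr, if_pos rfl]
    · intro u _ hus
      rw [relabelMatrix_apply_finsetCongr, if_neg (Ne.symm hus), zero_mul]
    · intro h; exact (h (Finset.mem_univ _)).elim
  · intro u _ hut
    rw [conjTranspose_apply, relabelMatrix_apply_finsetCongr, if_neg (Ne.symm hut), star_zero,
      mul_zero]
  · intro h; exact (h (Finset.mem_univ _)).elim

/-- `Γ(e) c†_i Γ(e)ᴴ = c†_{e i}`. [cite: BratteliRobinsonII1997, §5.2.2, Thm. 5.2.5 and eq. (5.2.13)] -/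
theorem relabelMatrix_mul_creation_mul_conjTranspose (e : ι ≃ ι') (i : ι) :
    relabelMatrix e * creation i * (relabelMatrix e)ᴴ = creation (e i) := by
  rw [← relabel_eq_relabelMatrix_mul, relabel_creation]

/-- `Γ(e) c_i Γ(e)ᴴ = c_{e i}`. [cite: BratteliRobinsonII1997, §5.2.2, Thm. 5.2.5 and eq. (5.2.13)] -/
theorem relabelMatrix_mul_annihilation_mul_conjTranspose (e : ι ≃ ι') (i : ι) :
    relabelMatrix e * annihilation i * (relabelMatrix e)ᴴ = annihilation (e i) := by
  rw [← relabel_eq_relabelMatrix_mul, relabel_annihilation]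

omit [Fintype ι] [Fintype ι'] in
/-- No inversions on the empty configuration: `ε_e(∅) = 1`. [folklore] -/
theorem relabelSign_empty (e : ι ≃ ι') : relabelSign e ∅ = 1 := by
  rw [relabelSign, invCount, Finset.sum_empty, pow_zero]

omit [Fintype ι] [Fintype ι'] in
/-- The column of `Γ(e)` at the vacuum: `Γ(e)_{s', ∅} = δ_{s', ∅}`. [folklore] -/
theorem relabelMatrix_apply_empty (e : ι ≃ ι') (s' : Finset ι') :
    relabelMatrix e s' ∅ = if s' = ∅ then 1 else 0 := by
  have h0 : e.finsetCongr (∅ : Finset ι) = ∅ := by simp [Equiv.finsetCongr_apply]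
  simp only [relabelMatrix, h0, relabelSign_empty]

omit [Fintype ι'] in
/-- `Γ(e)` fixes the vacuum: `Γ(e) |∅⟩ = |∅⟩`. [folklore] -/
theorem relabelMatrix_mulVec_vacuum (e : ι ≃ ι') :
    relabelMatrix e *ᵥ (vacuum : Fock ι) = (vacuum : Fock ι') := by
  ext s'
  simp only [vacuum, Matrix.mulVec, dotProduct, Pi.single_apply, mul_ite, mul_one, mul_zero,
    Finset.sum_ite_eq', Finset.mem_univ, if_true, relabelMatrix_apply_empty]

omit [Fintype ι] in
/-- The identity relabelling has no inversions. [folklore] -/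
theorem relabelSign_refl (s : Finset ι) : relabelSign (Equiv.refl ι) s = 1 := by
  rw [relabelSign, invCount]
  have : ∀ j ∈ s, (s.filter fun k => j < k ∧ (Equiv.refl ι) k < (Equiv.refl ι) j).card = 0 := by
    intro j _
    rw [Finset.card_eq_zero, Finset.filter_eq_empty_iff]
    intro k _ h
    exact lt_asymm h.1 h.2
  rw [Finset.sum_eq_zero this, pow_zero]

omit [Fintype ι] in
/-- `Γ(id) = 1`. [folklore] -/
theorem relabelMatrix_refl : relabelMatrix (Equiv.refl ι) = 1 := by
  ext s t
  have : (Equiv.refl ι).finsetCongr t = t := by simp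
  simp only [relabelMatrix, Matrix.one_apply, this, relabelSign_refl]

end RelabelMatrix

/-! ### The sign cocycle: `Γ(e ∘ f) = Γ(e) Γ(f)` -/

section Cocycle

variable {ι ι' ι'' : Type*} [LinearOrder ι] [LinearOrder ι'] [LinearOrder ι'']

/-- The weight of an ordered pair in the inversion count: `-1` if `j < k` is inverted by `e`,
`1` otherwise. [folklore] -/
def invWeight (e : ι ≃ ι') (j k : ι) : ℂ := if j < k ∧ e k < e j then -1 else 1

omit [LinearOrder ι'] in
/-- `(-1)^{#filter}` as a product of `±1` weights. [folklore] -/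
theorem neg_one_pow_card_filter {α : Type*} (s : Finset α) (p : α → Prop) [DecidablePred p] :
    ((-1 : ℂ) ^ (s.filter p).card) = ∏ x ∈ s, (if p x then (-1 : ℂ) else 1) := by
  rw [Finset.prod_ite, Finset.prod_const, Finset.prod_const_one, mul_one]

/-- The relabelling sign as a product of pair weights over ordered pairs. [folklore] -/
theorem relabelSign_eq_prod (e : ι ≃ ι') (t : Finset ι) :
    relabelSign e t = ∏ j ∈ t, ∏ k ∈ t, invWeight e j k := by
  rw [relabelSign, invCount, ← Finset.prod_pow_eq_pow_sum]
  refine Finset.prod_congr rfl fun j _ => ?_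
  rw [neg_one_pow_card_filter]
  rfl

omit [LinearOrder ι'] in
/-- Pairing the ordered pairs `(j, k)` and `(k, j)`: a double product of weights with trivial
diagonal is the product over `j < k` of `g j k * g k j`. [folklore] -/
theorem prod_prod_eq_prod_lt (t : Finset ι) (g : ι → ι → ℂ) (hdiag : ∀ a, g a a = 1) :
    ∏ j ∈ t, ∏ k ∈ t, g j k = ∏ j ∈ t, ∏ k ∈ t.filter (fun k => j < k), (g j k * g k j) := by
  -- split each inner product at `j`
  have hsplit : ∀ j ∈ t, ∏ k ∈ t, g j k =
      (∏ k ∈ t.filter (fun k => j < k), g j k) * ∏ k ∈ t.filter (fun k => k < j), g j k := by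
    intro j hj
    rw [← Finset.prod_filter_mul_prod_filter_not t (fun k => j < k)]
    congr 1
    rw [← Finset.prod_filter_mul_prod_filter_not (t.filter fun k => ¬ j < k) (fun k => k < j)]
    have h1 : ((t.filter fun k => ¬ j < k).filter fun k => k < j) = t.filter fun k => k < j := by
      ext k; simp only [Finset.mem_filter]; constructor
      · rintro ⟨⟨hk, -⟩, h⟩; exact ⟨hk, h⟩
      · rintro ⟨hk, h⟩; exact ⟨⟨hk, not_lt.2 h.le⟩, h⟩
    have h2 : ((t.filter fun k => ¬ j < k).filter fun k => ¬ k < j) = {j} := by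
      ext k; simp only [Finset.mem_filter, Finset.mem_singleton]; constructor
      · rintro ⟨⟨-, h1⟩, h2⟩; exact le_antisymm (not_lt.1 h1) (not_lt.1 h2)
      · rintro rfl; exact ⟨⟨hj, lt_irrefl _⟩, lt_irrefl _⟩
    rw [h1, h2, Finset.prod_singleton, hdiag, mul_one]
  rw [Finset.prod_congr rfl hsplit, Finset.prod_mul_distrib]
  -- swap the order in the second factor
  have hswap : ∏ j ∈ t, ∏ k ∈ t.filter (fun k => k < j), g j k =
      ∏ k ∈ t, ∏ j ∈ t.filter (fun j => k < j), g j k := by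
    refine Finset.prod_comm' ?_
    intro j k
    simp only [Finset.mem_filter]
    tauto
  rw [hswap, ← Finset.prod_mul_distrib]
  refine Finset.prod_congr rfl fun j _ => ?_
  rw [← Finset.prod_mul_distrib]

omit [LinearOrder ι] in
/-- The sign of `e` on the relabelled configuration `f(t)`, as a product over pairs of `t`.
[folklore] -/
theorem relabelSign_finsetCongr_eq_prod (f : ι ≃ ι') (e : ι' ≃ ι'') (t : Finset ι) :
    relabelSign e (f.finsetCongr t) = ∏ a ∈ t, ∏ b ∈ t, invWeight e (f a) (f b) := by
  rw [relabelSign_eq_prod, Equiv.finsetCongr_apply, Finset.prod_map]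
  refine Finset.prod_congr rfl fun a _ => ?_
  rw [Finset.prod_map]
  rfl

/-- The pair weights compose: for `a < b`,
`w_{e∘f}(a,b) w_{e∘f}(b,a) = (w_f(a,b) w_f(b,a)) · (w_e(fa,fb) w_e(fb,fa))`. [folklore] -/
theorem invWeight_trans_mul (f : ι ≃ ι') (e : ι' ≃ ι'') {a b : ι} (hab : a < b) :
    invWeight (f.trans e) a b * invWeight (f.trans e) b a =
      (invWeight f a b * invWeight f b a) * (invWeight e (f a) (f b) * invWeight e (f b) (f a)) := by
  have hba : ¬ b < a := not_lt.2 hab.le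
  have hfne : f a ≠ f b := fun h => hab.ne (f.injective h)
  have hefne : e (f a) ≠ e (f b) := fun h => hfne (e.injective h)
  simp only [invWeight, Equiv.trans_apply, hab, hba, true_and, false_and, if_false, mul_one]
  rcases lt_or_gt_of_ne hfne with h1 | h1
  · have h1' : ¬ f b < f a := not_lt.2 h1.le
    simp only [h1, h1', true_and, false_and, if_false, mul_one, one_mul]
  · have h1' : ¬ f a < f b := not_lt.2 h1.le
    simp only [h1, h1', true_and, false_and, if_false, if_true, one_mul]
    rcases lt_or_gt_of_ne hefne with h2 | h2
    · have h2' : ¬ e (f b) < e (f a) := not_lt.2 h2.le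
      simp [h2, h2']
    · have h2' : ¬ e (f a) < e (f b) := not_lt.2 h2.le
      simp [h2, h2']

/-- **The relabelling signs form a cocycle**: `ε_{e∘f}(t) = ε_f(t) · ε_e(f(t))` (the sorting
permutations compose). [folklore] -/
theorem relabelSign_trans (f : ι ≃ ι') (e : ι' ≃ ι'') (t : Finset ι) :
    relabelSign (f.trans e) t = relabelSign f t * relabelSign e (f.finsetCongr t) := by
  have hd1 : ∀ a, invWeight (f.trans e) a a = 1 := fun a => by simp [invWeight]
  have hd2 : ∀ a, invWeight f a a = 1 := fun a => by simp [invWeight]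
  have hd3 : ∀ a, invWeight e (f a) (f a) = 1 := fun a => by simp [invWeight]
  rw [relabelSign_eq_prod, relabelSign_eq_prod, relabelSign_finsetCongr_eq_prod,
    prod_prod_eq_prod_lt t _ hd1, prod_prod_eq_prod_lt t _ hd2,
    prod_prod_eq_prod_lt t (fun a b => invWeight e (f a) (f b)) hd3, ← Finset.prod_mul_distrib]
  refine Finset.prod_congr rfl fun a _ => ?_
  rw [← Finset.prod_mul_distrib]
  refine Finset.prod_congr rfl fun b hb => ?_
  exact invWeight_trans_mul f e (Finset.mem_filter.1 hb).2

variable [Fintype ι] [Fintype ι'] [Fintype ι'']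

omit [Fintype ι] [Fintype ι''] in
/-- **`Γ` is multiplicative**: `Γ(e ∘ f) = Γ(e) Γ(f)`. [cite: BratteliRobinsonII1997, §5.2.2, Thm. 5.2.5] -/
theorem relabelMatrix_trans (f : ι ≃ ι') (e : ι' ≃ ι'') :
    relabelMatrix (f.trans e) = relabelMatrix e * relabelMatrix f := by
  ext s'' t
  rw [Matrix.mul_apply, Finset.sum_eq_single (f.finsetCongr t)]
  · rw [relabelMatrix_apply_finsetCongr, if_pos rfl, relabelMatrix, relabelMatrix]
    have htr : (f.trans e).finsetCongr t = e.finsetCongr (f.finsetCongr t) := by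
      simp [Equiv.finsetCongr_apply, Finset.map_map]
    rw [htr]
    split_ifs with h
    · rw [relabelSign_trans, mul_comm]
    · rw [zero_mul]
  · intro u _ hu
    simp only [relabelMatrix, if_neg hu, mul_zero]
  · intro h; exact (h (Finset.mem_univ _)).elim

end Cocycle

/-! ### Conjugating diagonal operators; a uniqueness principle -/

section Diagonal

variable {ι ι' : Type*} [LinearOrder ι] [LinearOrder ι'] [Fintype ι] [Fintype ι']

/-- Relabelling a diagonal operator relabels its eigenvalue function:
`Γ(e) diag(d) Γ(e)ᴴ = diag(d ∘ e⁻¹)`. [folklore] -/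
theorem relabel_diagonal (e : ι ≃ ι') (d : Finset ι → ℂ) :
    relabel e (diagonal d) = diagonal fun s' => d (e.finsetCongr.symm s') := by
  ext s' t'
  obtain ⟨s, rfl⟩ := e.finsetCongr.surjective s'
  obtain ⟨t, rfl⟩ := e.finsetCongr.surjective t'
  rw [relabel_apply_finsetCongr, diagonal_apply, diagonal_apply, Equiv.symm_apply_apply]
  by_cases h : s = t
  · subst h
    rw [if_pos rfl, if_pos rfl, mul_comm (relabelSign e s), mul_assoc, relabelSign_mul_self, mul_one]
  · have h' : e.finsetCongr s ≠ e.finsetCongr t := fun h'' => h (e.finsetCongr.injective h'')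
    rw [if_neg h, if_neg h', mul_zero, zero_mul]

omit [Fintype ι'] [LinearOrder ι'] in
/-- `c†_i |s⟩ = σ_i(s) |s ∪ {i}⟩` for `i ∉ s`. [folklore] -/
theorem creation_mulVec_single_of_notMem (i : ι) {s : Finset ι} (hi : i ∉ s) :
    creation i *ᵥ Pi.single s (1 : ℂ) = jwSign i s • Pi.single (insert i s) 1 := by
  ext t
  rw [mulVec_single_one, col_apply, creation_apply, Pi.smul_apply, Pi.single_apply, smul_eq_mul,
    mul_ite, mul_one, mul_zero]
  by_cases ht : t = insert i s
  · rw [if_pos ⟨hi, ht⟩, if_pos ht]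
  · rw [if_neg (fun h => ht h.2), if_neg ht]

omit [Fintype ι'] [LinearOrder ι'] in
/-- **Uniqueness principle (cyclicity of the vacuum).** An operator that commutes with every
creation operator and fixes the vacuum is the identity — so a unitary implementing a given
relabelling of the creation operators and fixing the vacuum is unique. [folklore] -/
theorem eq_one_of_commute_creation_of_mulVec_vacuum (V : Matrix (Finset ι) (Finset ι) ℂ)
    (hc : ∀ i, V * creation i = creation i * V) (hv : V *ᵥ (vacuum : Fock ι) = vacuum) :
    V = 1 := by
  -- `V` fixes every occupation basis vector
  have key : ∀ s : Finset ι, V *ᵥ Pi.single s (1 : ℂ) = Pi.single s 1 := by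
    intro s
    induction s using Finset.induction_on with
    | empty => exact hv
    | insert i s hi ih =>
      have h1 : V *ᵥ (creation i *ᵥ Pi.single s (1 : ℂ)) = creation i *ᵥ (V *ᵥ Pi.single s 1) := by
        rw [mulVec_mulVec, mulVec_mulVec, hc i]
      rw [ih, creation_mulVec_single_of_notMem i hi, mulVec_smul] at h1
      have h2 := congrArg (fun w => jwSign i s • w) h1
      simp only [smul_smul, jwSign_mul_self, one_smul] at h2
      exact h2
  ext s t
  have := congrFun (key t) s
  rw [mulVec_single_one, col_apply] at this
  rw [this, Matrix.one_apply, Pi.single_apply, eq_comm]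

end Diagonal

/-! ### The hyperoctahedral group of a site set and its graded action on Fock space -/

section Hyperoctahedral

variable {Λ Λ' Λ'' : Type*}

/-- `Orb.mapEquiv` is functorial. [folklore] -/
theorem Orb.mapEquiv_trans (h : Λ ≃ Λ') (g : Λ' ≃ Λ'') :
    Orb.mapEquiv (h.trans g) = (Orb.mapEquiv h).trans (Orb.mapEquiv g) := rfl

/-- `Orb.mapEquiv` of the identity. [folklore] -/
theorem Orb.mapEquiv_refl : Orb.mapEquiv (Equiv.refl Λ) = Equiv.refl (Orb Λ) := rfl

/-- `Orb.mapEquiv` commutes with inverses. [folklore] -/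
theorem Orb.mapEquiv_symm (g : Λ ≃ Λ') : (Orb.mapEquiv g).symm = Orb.mapEquiv g.symm := rfl

/-- The site of an orbital. [folklore] -/
theorem Orb.fst_ofLex_mapEquiv (g : Λ ≃ Λ') (i : Orb Λ) :
    (ofLex (Orb.mapEquiv g i)).1 = g (ofLex i).1 := rfl

/-- The action of site permutations on site sign patterns `ε : Λ → ℤˣ`:
`(g · ε)(x) = ε(g⁻¹ x)`, as a homomorphism into `MulAut` (the structure map of the wreath product
`ℤ₂ ≀ S_Λ = (ℤ₂)^Λ ⋊ S_Λ`). [folklore] -/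
def signAut : Equiv.Perm Λ →* MulAut (Λ → ℤˣ) where
  toFun g := { toEquiv := Equiv.arrowCongr g (Equiv.refl ℤˣ), map_mul' := fun _ _ => rfl }
  map_one' := by ext ε x; rfl
  map_mul' g h := by ext ε x; rfl

/-- `signAut g ε = ε ∘ g⁻¹`. [folklore] -/
@[simp] theorem signAut_apply (g : Equiv.Perm Λ) (ε : Λ → ℤˣ) (x : Λ) :
    signAut g ε x = ε (g.symm x) := rfl

/-- **The hyperoctahedral group** `B_Λ = ℤ₂ ≀ S_Λ = (ℤ₂)^Λ ⋊ S_Λ` of the site set `Λ`: pairs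
(site sign pattern `ε`, site permutation `g`), Mathlib's `SemidirectProduct`. (Cf. the tree's
`Literature.Analysis.FluidPDE` signed-permutation isometries for the geometric incarnation.)
[folklore] -/
abbrev Hyperoctahedral (Λ : Type*) : Type _ := (Λ → ℤˣ) ⋊[signAut] Equiv.Perm Λ

/-- The coordinate reflection `r_x`: sign `-1` at `x`, `+1` elsewhere. [folklore] -/
def reflectAt [DecidableEq Λ] (x : Λ) : Λ → ℤˣ := Function.update 1 x (-1)

variable [LinearOrder Λ] [Fintype Λ]

/-- The sign of a configuration under a site sign pattern: `∏_{(x,σ) ∈ s} ε_x = ∏_x ε_x^{n_x(s)}`.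
[folklore] -/
def reflectionSign (ε : Λ → ℤˣ) (s : Finset (Orb Λ)) : ℂ := ∏ i ∈ s, ((ε (ofLex i).1 : ℤ) : ℂ)

omit [LinearOrder Λ] [Fintype Λ] in
/-- `reflectionSign` is multiplicative in the sign pattern. [folklore] -/
theorem reflectionSign_mul (ε ε' : Λ → ℤˣ) (s : Finset (Orb Λ)) :
    reflectionSign (ε * ε') s = reflectionSign ε s * reflectionSign ε' s := by
  simp only [reflectionSign, Pi.mul_apply, Units.val_mul, Int.cast_mul, Finset.prod_mul_distrib]

omit [LinearOrder Λ] [Fintype Λ] in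
/-- `reflectionSign 1 = 1`. [folklore] -/
theorem reflectionSign_one (s : Finset (Orb Λ)) : reflectionSign (1 : Λ → ℤˣ) s = 1 := by
  simp [reflectionSign]

omit [LinearOrder Λ] [Fintype Λ] in
/-- `reflectionSign ε s ∈ {±1}`: it squares to `1`. [folklore] -/
theorem reflectionSign_mul_self (ε : Λ → ℤˣ) (s : Finset (Orb Λ)) :
    reflectionSign ε s * reflectionSign ε s = 1 := by
  rw [← reflectionSign_mul, ← reflectionSign_one s]
  congr 1
  funext x
  simp [Int.units_mul_self]

omit [LinearOrder Λ] [Fintype Λ] in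
/-- `reflectionSign` is real. [folklore] -/
theorem star_reflectionSign (ε : Λ → ℤˣ) (s : Finset (Orb Λ)) :
    star (reflectionSign ε s) = reflectionSign ε s := by
  simp [reflectionSign]

/-- **The reflection operator** `R(ε) = ∏_x ε_x^{n_x}` (for `ε = r_x`: `(-1)^{n_x}`), diagonal in
the occupation basis. [folklore] -/
def reflectionMatrix (ε : Λ → ℤˣ) : Matrix (Finset (Orb Λ)) (Finset (Orb Λ)) ℂ :=
  diagonal (reflectionSign ε)

/-- `R(ε)` is unitary. [folklore] -/
theorem reflectionMatrix_mem_unitary (ε : Λ → ℤˣ) :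
    reflectionMatrix ε ∈ Matrix.unitaryGroup (Finset (Orb Λ)) ℂ := by
  rw [Unitary.mem_iff, star_eq_conjTranspose, reflectionMatrix, diagonal_conjTranspose,
    diagonal_mul_diagonal, diagonal_mul_diagonal, ← diagonal_one]
  constructor <;> (congr 1; funext s; simp [star_reflectionSign, reflectionSign_mul_self])

/-- The reflections as a homomorphism `(ℤ₂)^Λ →* U(𝓕)`. [folklore] -/
def reflectionRep : (Λ → ℤˣ) →* Matrix.unitaryGroup (Finset (Orb Λ)) ℂ where
  toFun ε := ⟨reflectionMatrix ε, reflectionMatrix_mem_unitary ε⟩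
  map_one' := Subtype.ext (by
    show reflectionMatrix 1 = 1
    rw [reflectionMatrix, ← diagonal_one]
    congr 1; funext s; exact reflectionSign_one s)
  map_mul' ε ε' := Subtype.ext (by
    show reflectionMatrix (ε * ε') = reflectionMatrix ε * reflectionMatrix ε'
    rw [reflectionMatrix, reflectionMatrix, reflectionMatrix, diagonal_mul_diagonal]
    congr 1; funext s; exact reflectionSign_mul ε ε' s)

/-- `Γ(g)` is unitary. [folklore] -/
theorem relabelMatrix_mem_unitary (e : Orb Λ ≃ Orb Λ) :
    relabelMatrix e ∈ Matrix.unitaryGroup (Finset (Orb Λ)) ℂ := by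
  rw [Unitary.mem_iff, star_eq_conjTranspose]
  exact ⟨conjTranspose_mul_relabelMatrix e, relabelMatrix_mul_conjTranspose e⟩

/-- **Second quantisation of site permutations** as a homomorphism `S_Λ →* U(𝓕)`,
`g ↦ Γ(Orb.mapEquiv g)` (relabel the occupied orbitals, multiply by the sign of the sorting
permutation). [cite: BratteliRobinsonII1997, §5.2.2, Thm. 5.2.5] -/
def permRep : Equiv.Perm Λ →* Matrix.unitaryGroup (Finset (Orb Λ)) ℂ where
  toFun g := ⟨relabelMatrix (Orb.mapEquiv g), relabelMatrix_mem_unitary _⟩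
  map_one' := Subtype.ext (by
    show relabelMatrix (Orb.mapEquiv (Equiv.refl Λ)) = 1
    rw [Orb.mapEquiv_refl, relabelMatrix_refl])
  map_mul' g h := Subtype.ext (by
    show relabelMatrix (Orb.mapEquiv (g * h)) =
      relabelMatrix (Orb.mapEquiv g) * relabelMatrix (Orb.mapEquiv h)
    rw [Equiv.Perm.mul_def, Orb.mapEquiv_trans, relabelMatrix_trans])

omit [LinearOrder Λ] [Fintype Λ] in
/-- `reflectionSign` transforms under relabelling by the site permutation. [folklore] -/
theorem reflectionSign_finsetCongr_symm (g : Equiv.Perm Λ) (ε : Λ → ℤˣ) (s' : Finset (Orb Λ)) :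
    reflectionSign ε ((Orb.mapEquiv g).finsetCongr.symm s') = reflectionSign (signAut g ε) s' := by
  rw [Equiv.finsetCongr_symm, Equiv.finsetCongr_apply, reflectionSign, Finset.prod_map,
    reflectionSign]
  rfl

/-- **Compatibility**: `Γ(g) R(ε) Γ(g)⁻¹ = R(g · ε)` — permuting the sites of a reflection
pattern. [folklore] -/
theorem permRep_conj_reflectionRep (g : Equiv.Perm Λ) (ε : Λ → ℤˣ) :
    reflectionRep (signAut g ε) = permRep g * reflectionRep ε * (permRep g)⁻¹ := by
  apply Subtype.ext
  show reflectionMatrix (signAut g ε) =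
    relabelMatrix (Orb.mapEquiv g) * reflectionMatrix ε * star (relabelMatrix (Orb.mapEquiv g))
  rw [star_eq_conjTranspose, ← relabel_eq_relabelMatrix_mul]
  unfold reflectionMatrix
  rw [relabel_diagonal]
  congr 1
  funext s'
  exact (reflectionSign_finsetCongr_symm g ε s').symm

/-- **The graded action `π` of the hyperoctahedral group `ℤ₂ ≀ S_Λ` on fermionic Fock space**
`𝓕(Orb Λ)` (`Orb Λ = Λ ×ₗ Fin 2`): the unitary representation with `π(ε, 1) = R(ε) = ∏_x ε_x^{n_x}`
(so `π(r_x) = (-1)^{n_x}`, `reflectAt`) and `π(1, g) = Γ(g)` the second quantisation of the site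
permutation (`π(g) c†_{xσ} π(g)⁻¹ = c†_{g x, σ}`, `π(g)|vac⟩ = |vac⟩`), assembled by
`SemidirectProduct.lift` from `reflectionRep`, `permRep` and their compatibility. This is the
"graded" (fermionic-sign) permutation action of Dirac 1929 / the graded permutations of the
supersymmetric `t`-`J` model (Sarkar 1991; Essler–Korepin 1992), for the wreath product as in
Regev 1986 / Sergeev 1984. [cite: BratteliRobinsonII1997, §5.2.2, Thm. 5.2.5 (second quantisation of one-particle unitaries)] -/
def gradedHyperoctahedralFockAction :
    Hyperoctahedral Λ →* Matrix.unitaryGroup (Finset (Orb Λ)) ℂ :=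
  SemidirectProduct.lift reflectionRep permRep fun g => by
    ext ε : 1
    simp only [MonoidHom.coe_comp, MulEquiv.coe_toMonoidHom, Function.comp_apply,
      MulAut.conj_apply]
    exact permRep_conj_reflectionRep g ε

/-! ### API -/

/-- `π` on a pure permutation is `Γ(g)`. [folklore] -/
theorem gradedHyperoctahedralFockAction_inr (g : Equiv.Perm Λ) :
    (gradedHyperoctahedralFockAction (SemidirectProduct.inr g)).val = relabelMatrix (Orb.mapEquiv g) := by
  rw [gradedHyperoctahedralFockAction, SemidirectProduct.lift_inr]
  rfl

/-- `π` on a pure sign pattern is `R(ε)`. [folklore] -/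
theorem gradedHyperoctahedralFockAction_inl (ε : Λ → ℤˣ) :
    (gradedHyperoctahedralFockAction (SemidirectProduct.inl ε)).val = reflectionMatrix ε := by
  rw [gradedHyperoctahedralFockAction, SemidirectProduct.lift_inl]
  rfl

/-- **`π(g) c†_{xσ} π(g)ᴴ = c†_{g x, σ}`.** [cite: BratteliRobinsonII1997, §5.2.2, Thm. 5.2.5 and eq. (5.2.13)] -/
theorem gradedHyperoctahedralFockAction_conj_creation (g : Equiv.Perm Λ) (x : Λ) (σ : Fin 2) :
    (gradedHyperoctahedralFockAction (SemidirectProduct.inr g)).val *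
        creation (orb x σ) * (gradedHyperoctahedralFockAction (SemidirectProduct.inr g)).valᴴ = creation (orb (g x) σ) := by
  rw [gradedHyperoctahedralFockAction_inr, relabelMatrix_mul_creation_mul_conjTranspose,
    Orb.mapEquiv_orb]

/-- **`π(g) c_{xσ} π(g)ᴴ = c_{g x, σ}`.** [cite: BratteliRobinsonII1997, §5.2.2, Thm. 5.2.5 and eq. (5.2.13)] -/
theorem gradedHyperoctahedralFockAction_conj_annihilation (g : Equiv.Perm Λ) (x : Λ) (σ : Fin 2) :
    (gradedHyperoctahedralFockAction (SemidirectProduct.inr g)).val *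
        annihilation (orb x σ) * (gradedHyperoctahedralFockAction (SemidirectProduct.inr g)).valᴴ = annihilation (orb (g x) σ) := by
  rw [gradedHyperoctahedralFockAction_inr, relabelMatrix_mul_annihilation_mul_conjTranspose,
    Orb.mapEquiv_orb]

/-- **`π(g)` fixes the vacuum.** [folklore] -/
theorem gradedHyperoctahedralFockAction_inr_mulVec_vacuum (g : Equiv.Perm Λ) :
    (gradedHyperoctahedralFockAction (SemidirectProduct.inr g)).val *ᵥ
      (vacuum : Fock (Orb Λ)) = vacuum := by
  rw [gradedHyperoctahedralFockAction_inr, relabelMatrix_mulVec_vacuum]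

/-- `π(ε)` fixes the vacuum. [folklore] -/
theorem gradedHyperoctahedralFockAction_inl_mulVec_vacuum (ε : Λ → ℤˣ) :
    (gradedHyperoctahedralFockAction (SemidirectProduct.inl ε)).val *ᵥ
      (vacuum : Fock (Orb Λ)) = vacuum := by
  rw [gradedHyperoctahedralFockAction_inl, reflectionMatrix, vacuum]
  ext s
  simp only [mulVec_diagonal, Pi.single_apply, reflectionSign, mul_ite, mul_one, mul_zero]
  split_ifs with h
  · subst h; simp
  · rfl

/-- **`π(g)` conjugates number operators covariantly**: `π(g) n_{xσ} π(g)ᴴ = n_{g x, σ}`.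
[folklore] -/
theorem gradedHyperoctahedralFockAction_conj_numberOp (g : Equiv.Perm Λ) (x : Λ) (σ : Fin 2) :
    (gradedHyperoctahedralFockAction (SemidirectProduct.inr g)).val *
        numberOp x σ * (gradedHyperoctahedralFockAction (SemidirectProduct.inr g)).valᴴ = numberOp (g x) σ := by
  rw [gradedHyperoctahedralFockAction_inr, ← relabel_eq_relabelMatrix_mul,
    relabel_mapEquiv_numberOp]

/-- **`π(g)` commutes with the total particle number.** [folklore] -/
theorem gradedHyperoctahedralFockAction_inr_mul_totalNumber (g : Equiv.Perm Λ) :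
    (gradedHyperoctahedralFockAction (SemidirectProduct.inr g)).val * totalNumber =
      totalNumber * (gradedHyperoctahedralFockAction (SemidirectProduct.inr g)).val := by
  have h := relabel_mapEquiv_totalNumber (Λ := Λ) g
  rw [relabel_eq_relabelMatrix_mul] at h
  have h2 := congrArg (fun a => a * relabelMatrix (Orb.mapEquiv g)) h
  simp only [Matrix.mul_assoc, conjTranspose_mul_relabelMatrix, Matrix.mul_one] at h2
  rw [gradedHyperoctahedralFockAction_inr]
  exact h2

/-- From invariance under conjugation to commutation: `Γ A Γᴴ = A ⇒ Γ A = A Γ`. [folklore] -/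
theorem relabelMatrix_mul_eq_mul_of_relabel_eq (e : Orb Λ ≃ Orb Λ)
    {A : Matrix (Finset (Orb Λ)) (Finset (Orb Λ)) ℂ} (h : relabel e A = A) :
    relabelMatrix e * A = A * relabelMatrix e := by
  rw [relabel_eq_relabelMatrix_mul] at h
  have h2 := congrArg (fun a => a * relabelMatrix e) h
  simp only [Matrix.mul_assoc, conjTranspose_mul_relabelMatrix, Matrix.mul_one] at h2
  exact h2

/-- `S^z` is invariant under site bijections. [folklore] -/
theorem relabel_mapEquiv_spinZ (f : Equiv.Perm Λ) :
    relabel (Orb.mapEquiv f) (HubbardWave0.spinZ : Matrix (Finset (Orb Λ)) (Finset (Orb Λ)) ℂ) =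
      HubbardWave0.spinZ := by
  rw [HubbardWave0.spinZ, map_smul, map_sum]
  simp_rw [map_sub, relabel_mapEquiv_numberOp]
  congr 1
  exact Equiv.sum_comp f (fun x' => numberOp x' 0 - numberOp x' 1)

/-- `S⁺` is invariant under site bijections. [folklore] -/
theorem relabel_mapEquiv_spinPlus (f : Equiv.Perm Λ) :
    relabel (Orb.mapEquiv f) (spinPlus : Matrix (Finset (Orb Λ)) (Finset (Orb Λ)) ℂ) = spinPlus := by
  rw [spinPlus, map_sum]
  simp_rw [map_mul, relabel_creation, relabel_annihilation, Orb.mapEquiv_orb]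
  exact Equiv.sum_comp f (fun x' => creation (orb x' 0) * annihilation (orb x' 1))

/-- `S²` is invariant under site bijections. [folklore] -/
theorem relabel_mapEquiv_spinSq (f : Equiv.Perm Λ) :
    relabel (Orb.mapEquiv f) (spinSq : Matrix (Finset (Orb Λ)) (Finset (Orb Λ)) ℂ) = spinSq := by
  rw [spinSq, map_add, map_mul, map_smul, map_add, map_mul, map_mul, relabel_conjTranspose,
    relabel_mapEquiv_spinZ, relabel_mapEquiv_spinPlus]

/-- **`π(g)` commutes with `S^z`, `S⁺` and `S²`.** [folklore] -/
theorem gradedHyperoctahedralFockAction_inr_mul_spin (g : Equiv.Perm Λ) :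
    (gradedHyperoctahedralFockAction (SemidirectProduct.inr g)).val * HubbardWave0.spinZ =
        HubbardWave0.spinZ * (gradedHyperoctahedralFockAction (SemidirectProduct.inr g)).val ∧
      (gradedHyperoctahedralFockAction (SemidirectProduct.inr g)).val * spinPlus =
        spinPlus * (gradedHyperoctahedralFockAction (SemidirectProduct.inr g)).val ∧
      (gradedHyperoctahedralFockAction (SemidirectProduct.inr g)).val * spinSq =
        spinSq * (gradedHyperoctahedralFockAction (SemidirectProduct.inr g)).val := by
  rw [gradedHyperoctahedralFockAction_inr]
  exact ⟨relabelMatrix_mul_eq_mul_of_relabel_eq _ (relabel_mapEquiv_spinZ g),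
    relabelMatrix_mul_eq_mul_of_relabel_eq _ (relabel_mapEquiv_spinPlus g),
    relabelMatrix_mul_eq_mul_of_relabel_eq _ (relabel_mapEquiv_spinSq g)⟩

/-- **Reflections commute with all number operators** (both are diagonal in the occupation
basis). [folklore] -/
theorem gradedHyperoctahedralFockAction_inl_commute_numberOp (ε : Λ → ℤˣ) (x : Λ) (σ : Fin 2) :
    Commute (gradedHyperoctahedralFockAction (SemidirectProduct.inl ε)).val (numberOp x σ) := by
  rw [gradedHyperoctahedralFockAction_inl, reflectionMatrix, numberOp, ← numberAt,
    numberAt_eq_diagonal]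
  exact Matrix.commute_diagonal _ _

/-- **The coordinate reflection acts as the site parity**:
`π(r_x) = (1 - 2 n_{x↑})(1 - 2 n_{x↓}) = (-1)^{n_x}`. [folklore] -/
theorem gradedHyperoctahedralFockAction_reflectAt (x : Λ) :
    (gradedHyperoctahedralFockAction (SemidirectProduct.inl (reflectAt x))).val =
      (1 - 2 • numberOp x 0) * (1 - 2 • numberOp x 1) := by
  rw [gradedHyperoctahedralFockAction_inl, reflectionMatrix, numberOp, numberOp, ← numberAt,
    ← numberAt, one_sub_two_smul_numberAt_eq_diagonal, one_sub_two_smul_numberAt_eq_diagonal,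
    ← map_mul, diagonalRingHom_apply]
  congr 1
  funext s
  -- `∏_{i ∈ s} (r_x)_{site i} = (±1 for orb x 0) · (±1 for orb x 1)`
  have hw : ∀ i : Orb Λ, (((reflectAt x ((ofLex i).1) : ℤˣ) : ℤ) : ℂ) =
      ∏ σ : Fin 2, (if i = orb x σ then (-1 : ℂ) else 1) := by
    intro i
    by_cases hi : (ofLex i).1 = x
    · have : i = orb x (ofLex i).2 := by
        rw [← hi]; rfl
      rw [Fin.prod_univ_two, hi, reflectAt, Function.update_self]
      rcases Fin.exists_fin_two.1 ⟨(ofLex i).2, rfl⟩ with h0 | h1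
      · rw [h0] at this
        rw [if_pos this, if_neg]
        · simp
        · rw [this]; exact fun h => by cases congrArg (fun j => (ofLex j).2) h
      · rw [h1] at this
        rw [if_neg, if_pos this]
        · simp
        · rw [this]; exact fun h => by cases congrArg (fun j => (ofLex j).2) h
    · rw [reflectAt, Function.update_of_ne hi, Pi.one_apply, Units.val_one, Int.cast_one]
      rw [Fin.prod_univ_two, if_neg, if_neg, one_mul]
      · exact fun h => hi (by rw [h]; rfl)
      · exact fun h => hi (by rw [h]; rfl)
  rw [reflectionSign, Finset.prod_congr rfl (fun i _ => hw i), Finset.prod_comm,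
    Pi.mul_apply, Fin.prod_univ_two, Finset.prod_ite_eq', Finset.prod_ite_eq']

/-- **The Hubbard interaction as the class sum of reflections**:
`U ∑_x (n_{x↑} - ½)(n_{x↓} - ½) = (U/4) ∑_x π(r_x)`. [folklore] -/
theorem hubbardInteraction_eq_sum_reflectAt (U : ℂ) :
    U • ∑ x : Λ, (numberOp x 0 - diagonal (fun _ => (1 / 2 : ℂ))) *
        (numberOp x 1 - diagonal (fun _ => (1 / 2 : ℂ))) =
      (U / 4) • ∑ x : Λ, (gradedHyperoctahedralFockAction (SemidirectProduct.inl (reflectAt x))).val := by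
  have hn : ∀ (y : Λ) (σ : Fin 2), (numberOp y σ : Matrix (Finset (Orb Λ)) (Finset (Orb Λ)) ℂ) =
      diagonalRingHom (Finset (Orb Λ)) ℂ (fun s => if orb y σ ∈ s then 1 else 0) := fun y σ =>
    numberAt_eq_diagonal _
  have hh : (diagonal (fun _ => (1 / 2 : ℂ)) : Matrix (Finset (Orb Λ)) (Finset (Orb Λ)) ℂ) =
      diagonalRingHom (Finset (Orb Λ)) ℂ (fun _ => 1 / 2) := rfl
  have hr : ∀ y : Λ, (gradedHyperoctahedralFockAction (SemidirectProduct.inl (reflectAt y))).val =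
      diagonalRingHom (Finset (Orb Λ)) ℂ ((fun s => if orb y 0 ∈ s then -1 else 1) *
        fun s => if orb y 1 ∈ s then -1 else 1) := by
    intro y
    rw [gradedHyperoctahedralFockAction_reflectAt, numberOp, numberOp, ← numberAt, ← numberAt,
      one_sub_two_smul_numberAt_eq_diagonal, one_sub_two_smul_numberAt_eq_diagonal, ← map_mul]
  simp_rw [hr, hn, hh, ← map_sub, ← map_mul, ← map_sum, diagonalRingHom_apply, ← diagonal_smul]
  congr 1
  funext s
  simp only [Finset.sum_apply, Pi.smul_apply, Pi.mul_apply, Pi.sub_apply, smul_eq_mul,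
    Finset.mul_sum]
  refine Finset.sum_congr rfl fun y _ => ?_
  split_ifs <;> ring

end Hyperoctahedral

end Literature.MathematicalPhysics.QuantumLattice
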